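/-
Origin: expansion seat `planner-pub-hodgecm-pv03-0`, handover 2026-08-18 (`HOME/pub-hodgecm-pv03/lean/Pv03/PerL34/CharSpansWeil.lean`, md5 56c53e54, 133 lines);
landed by the gen-6 packager in gate run 22 as `HodgeCM/PerL34/CharSpansWeil.lean` (import ^import Pv14\.PerL34\.P43WeilModel\b→import HodgeCM.PerL34.P43_weilModel ×1; import ^import Pv[0-9]+g[0-9]+\.PerL34\.→import HodgeCM.PerL34. ×1; import ^import Pv[0-9]+\.PerL34\.→import HodgeCM.PerL34. ×1).
-/
/-
Origin: HOME/pub-hodgecm-pv03/lean/Pv03/PerL34/CharSpansWeil.lean — session planner-pub-hodgecm-pv03-0 (unit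
pub-hodgecm-pv03, DAG-NODE PROVER #03, node N33 holder).  Intended final place: `HodgeCM/PerL34/CharSpansWeil.lean`,
AFTER (all run 22) pv02-g2's `CharSpans.lean` (9c9ff4da → `HodgeCM.PerL34.CharSpans`), pv14's `P43WeilModel.lean`
(78153823 → `HodgeCM.PerL34.P43_weilModel`, which needs pv14's `P43Bridge` v2 → `P43_bridge` and `P43Isotypic` →
`P43_isotypic`) and pv03's `BallFrame.lean` (v7.3 19a49ace → `HodgeCM.PerL34.BallFrame`).
PACKAGER: the three `import Pv…` lines below become `import HodgeCM.PerL34.CharSpans`,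
`import HodgeCM.PerL34.P43_weilModel`, `import HodgeCM.PerL34.BallFrame`.  KERNEL: nothing cited, nothing asserted.
-/
import Summits.HodgeConjecture.HodgeCM.PerL34.CharSpans
import Summits.HodgeConjecture.HodgeCM.PerL34.P43_weilModel
import Summits.HodgeConjecture.HodgeCM.PerL34.BallFrame

/-!
# Seam S1 wired BY NAME: `GroupInputs ⇐` Weil typing (pv14), `HolFromBall ⇐ HolFrame` (pv03)

LEMMAS v6 (c), first item.  For pv02-g2's per-context data `M : CharSpans.CharLineSpans T V c` (pv02's function
model over the ball model with the side-(12) character set as index), the residual `M.Inputs` of node N33 on the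
pv03 ball route has, besides `Dense Δ` (PRINT: real approximation) and the three dictionary Props, two binders that
other seats have now reduced BY NAME:

* `GroupInputs` (pv02's five INPUT Props `LeftInvariant ∧ CompactInvariant ∧ FiniteStable ∧ UHolomorphic ∧
  SomeNonzero`) ⇐ pv14's N33b capstone `P43WeilModel.groupInputs_of_weilModel`: one `WeilTyping` per `(i, χ)`
  (DEFINITIONAL `θ_φ(x) = Θ(ω(x)φ)` + PRINT "ω is a representation of the product group" + DEFINITIONAL
  `S[𝔭₊ ⊠ 𝟏]`), N10 in invariant form (`hΘ`), (X1) per `(i, χ)`, (X2), `SomeNonzero` (N30 + N33a) — packaged here as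
  the record `WeilPackage M`;
* `HolFromBall` (D2/D6) ⇐ the intrinsic `BallFrame.HolFrame` ("every element of `Hol` is a continuous
  right-`K`-equivariant `ℂ²`-valued function on `U(2,1)`"), by `BallFrame.holFromBall_of_frame`.

`inputs_of_weil` assembles `M.Inputs` from these; `charSpanStepsInput_of_weil` gives pv02-g2's `CharSpanStepsInput T`
from the per-context package `WeilStepsInput T`, whence `Open_thetaWedge` (node N33) by pv02-g2's
`open_thetaWedge_of_cluster` / `open_thetaWedge_of_charSpans`.
-/

set_option autoImplicit false

noncomputable section

namespace HodgeCM
namespace PerL34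
namespace CharSpansWeil

open HodgeCM.PerL34.BallModel HodgeCM.PerL34.BallSpans HodgeCM.PerL34.BallFrame HodgeCM.PerL34.CharSpans
  HodgeCM.PerL34.WedgeNonvanishing HodgeCM.PerL34.WedgeToClasses HodgeCM.PerL34.P43WeilModel

variable {U : Universe} {T : U.ThetaModel} {L : CMField} {ι₁ : L →+* ℂ} {V : HermSpace3 L ι₁} {c : SeesawCtx L}

/-- pv02's `LineSpanData` of the model `M` (archimedean group `U21`, fibre `ℂ²`). -/
abbrev D (M : CharLineSpans T V c) : P43.LineSpanData := M.toBallSpanModel.toLineSpans.D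

/-- **The Weil-typing package of `M`** = exactly the binders of pv14's `groupInputs_of_weilModel` at `D M`: a forms
dictionary with the same `Hol`, per `(i, χ)` a theta-kernel model with the same slice `Θ_i(χ)[𝔭₊]` and its
`WeilTyping`, N10 in invariant form, (X1), (X2), and `SomeNonzero`. -/
structure WeilPackage (M : CharLineSpans T V c) where
  /-- the forms dictionary (pv14 `P43_forms`) -/
  FD : P43Forms.FormsDictionary (D M).Ginf (D M).V
  hHol : FD.Hol = (D M).Hol
  /-- the Fock–Schwartz model spaces, per fixed line `i` and character `χ` -/
  S : (i : Fin 2) → (D M).X i → Type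
  [iS₁ : ∀ i χ, AddCommGroup (S i χ)]
  [iS₂ : ∀ i χ, Module ℂ (S i χ)]
  /-- the theta-kernel models with the slices of `M` -/
  Mk : (i : Fin 2) → (χ : (D M).X i) → P43Forms.ThetaKernelData (D M).Ginf (D M).Gc (D M).Gf (D M).V (S i χ)
  hM : ∀ i χ, (Mk i χ).ThetaP = (D M).ThetaP i χ
  /-- the compact group `K_c` and the `K`-type `𝔭₊` -/
  Kc : Type
  P : Type
  [iP₁ : AddCommGroup P]
  [iP₂ : Module ℂ P]
  ρP : Kc → P →ₗ[ℂ] P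
  ωinf : (i : Fin 2) → (χ : (D M).X i) → (D M).Ginf → S i χ →ₗ[ℂ] S i χ
  ρ : (i : Fin 2) → (χ : (D M).X i) → Kc → S i χ →ₗ[ℂ] S i χ
  /-- the Weil typing per `(i, χ)` (pv14) -/
  W : ∀ i χ, WeilTyping (Mk i χ) (ωinf i χ) (ρ i χ) ρP
  /-- N10 in invariant form -/
  hΘ : ∀ i χ, ∀ γ ∈ (D M).Γ,
    (W i χ).Θ ∘ₗ (ωinf i χ γ.1 ∘ₗ (Mk i χ).ωc γ.2.1 ∘ₗ (Mk i χ).ωf γ.2.2) = (W i χ).Θ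
  /-- (X1) per `(i, χ)` -/
  hX1 : ∀ i χ, P43Forms.ThetaPKilledByPminus FD (Mk i χ)
  /-- (X2) -/
  hX2 : P43Forms.HolomorphicOfPminus FD
  /-- N30 + N33a -/
  hne : (D M).SomeNonzero

attribute [instance] WeilPackage.iS₁ WeilPackage.iS₂ WeilPackage.iP₁ WeilPackage.iP₂

variable (M : CharLineSpans T V c)

/-- **`GroupInputs` by name** from the Weil package (pv14 `groupInputs_of_weilModel`). -/
theorem groupInputs_of_weil (P : WeilPackage M) : M.toBallSpanModel.GroupInputs :=
  groupInputs_of_weilModel (D M) P.FD P.hHol P.S P.Mk P.hM P.ρP P.ωinf P.ρ P.W P.hΘ P.hX1 P.hX2 P.hne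

/-- **`HolFromBall` by name** from the intrinsic frame condition (pv03 `BallFrame.holFromBall_of_frame`). -/
theorem holFromBall_of_holFrame (h : HolFrame M.toBallSpanModel.toLineSpans) :
    M.toBallSpanModel.toLineSpans.HolFromBall :=
  holFromBall_of_frame M.toBallSpanModel.toLineSpans h

/-- **`M.Inputs` assembled**: Weil package + `HolFrame` + `Dense Δ` (PRINT) + the three dictionary Props. -/
theorem inputs_of_weil (P : WeilPackage M) (hH : HolFrame M.toBallSpanModel.toLineSpans)
    (hΔ : Dense (M.toBallSpanModel.toBallFormsModel.Δ : Set U21))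
    (h₀ : M.toBallSpanModel.toBallFormsModel.toFormsModelT.Dict_thetaClass₀ T c)
    (h₁ : M.toBallSpanModel.toBallFormsModel.toFormsModelT.Dict_thetaClass₁ T c)
    (hcup : M.toBallSpanModel.toBallFormsModel.toFormsModelT.toFormsModel.Dict_cupWedge) : M.Inputs :=
  ⟨groupInputs_of_weil M P, holFromBall_of_holFrame M hH, hΔ, h₀, h₁, hcup⟩

variable (T)

/-- **The per-context residual of node N33 with S1 wired**: per good context, the data `M`, a Weil package,
`HolFrame`, `Dense Δ`, and the three dictionary Props. -/
def WeilStepsInput : Prop :=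
  ∀ {L : CMField} {ι₁ : L →+* ℂ} (V : HermSpace3 L ι₁) (c : SeesawCtx L), T.GoodCtx ι₁ c →
    ∃ M : CharLineSpans T V c, Nonempty (WeilPackage M) ∧ HolFrame M.toBallSpanModel.toLineSpans ∧
      Dense (M.toBallSpanModel.toBallFormsModel.Δ : Set U21) ∧
      M.toBallSpanModel.toBallFormsModel.toFormsModelT.Dict_thetaClass₀ T c ∧
      M.toBallSpanModel.toBallFormsModel.toFormsModelT.Dict_thetaClass₁ T c ∧
      M.toBallSpanModel.toBallFormsModel.toFormsModelT.toFormsModel.Dict_cupWedge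

/-- (Ported verbatim from the HodgeCMPerL package; no docstring in the source.) -/
theorem charSpanStepsInput_of_weil (h : WeilStepsInput T) : CharSpanStepsInput T := by
  intro L ι₁ V c hc
  obtain ⟨M, ⟨P⟩, hH, hΔ, h₀, h₁, hcup⟩ := h V c hc
  exact ⟨M, inputs_of_weil M P hH hΔ h₀ h₁ hcup⟩

/-- **A6 `Open_thetaWedge` (node N33) with seams S1 and S2 wired by name**: `N33eClosed` (pv01, KERNEL), pv13's
cluster outputs (N31, for allowedness), and `WeilStepsInput T`. -/
theorem open_thetaWedge_of_weil (hE : N33eClosed) (h31 : ClusterOutputs T) (h : WeilStepsInput T) :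
    T.Open_thetaWedge :=
  open_thetaWedge_of_cluster T hE h31 (charSpanStepsInput_of_weil T h)

end CharSpansWeil
end PerL34
end HodgeCM

end
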